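import Literature.NumberTheory.Sieve.MontgomeryVaughan1975Section6A
import Literature.NumberTheory.Sieve.MontgomeryVaughan1975MinorArcs
import HarnessLib

/-!
# Montgomery–Vaughan (1975), §6 part B: (6.5)–(6.8), the major-arc remainder bounded by `W` — PROVED

H. L. Montgomery, R. C. Vaughan, *The exceptional set in Goldbach's problem*, Acta Arith. 27
(1975) 353–370 [MontgomeryVaughanActa1975], §6, pp. 362–363. Second layer of the discharge of the
named fact `section6_formulae`: starting from (6.4) in general form (`Section6A`), insert
`S(χ, η) = 𝟙_{χ=χ₀} T(η) + W(χ, η)`, bound the cross and bilinear terms by Cauchy–Schwarz, (6.5) and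
(6.7), regroup by primitive characters and apply LEMMA 5.5 (PROVED, `GaussSums`):

`majorArc_remainder_bound`: for `X ≥ 0`, `Q ≥ 2`, `2P < Q`, `n ≥ 1`,
`|R₁(n) − ∑_{q≤P} φ(q)⁻² c_q(−n) τ(χ̄₀)² ∫_{−1/qQ}^{1/qQ} T(η)² e(−nη) dη|
 ≤ 4e² (n/φ(n)) (2 X^{1/2} W + W²)`, `W = errTotal P Q X` — this is **(6.8)** with the implied
constant `8e²`; the main terms are `majorArcMainTerm` (to be evaluated in part C, (6.10)–(6.16)).

* `norm_integral_mul_mul_fourierChar_le` — Cauchy–Schwarz `|∫ f g e(−n·)| ≤ ‖f‖₂ ‖g‖₂` (Hölder);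
* `integral_norm_trigPoly_sq` — Parseval on a unit interval; `integral_norm_linSum_sq_le` — **(6.7)**
  `∫_{−h}^{h} |T|² ≤ X` (`h ≤ 1/2`);
* `wFun`, `wNorm` — `W(χ, η) = S(χ, η) − 𝟙_{χ=χ₀}T(η)` and `W(χ*) = (∫_{|η|≤1/(rQ)} |W(χ,η)|²)^{1/2}`
  (`r` the conductor) for arbitrary `χ` mod `q ≤ P`; `wFun_changeLevel`, `wNorm_changeLevel`: for
  `χ = ψχ₀`, `ψ` primitive, these are the `errSum`/`errNorm` of `ψ` (ErrorTerms); **(6.5)**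
  `integral_norm_wFun_sq_le`: `∫_{|η|≤1/(qQ)} |W(χ,η)|² ≤ W(χ*)²`;
* `norm_arcSum_sub_main_le` — **(6.6) at one modulus**: `|∑'_a ∫ S² e − main_q| ≤ φ(q)⁻²
  (2X^{1/2}|τ(χ̄₀)| ∑_χ |c_χ(−n)||τ(χ̄)| W(χ*) + ∑_{χ,χ'} |c_{χχ'}(−n)||τ(χ̄)||τ(χ̄')| W(χ*)W(χ'*))`;
* `sum_char_eq_sum_divisors_primitive` — `∑_{χ mod q} G(χ) = ∑_{r∣q} ∑*_{ψ mod r} G(ψχ₀)` (every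
  character is induced by a unique primitive one: Mathlib `primitiveCharacter`,
  `conductor_changeLevel`, `changeLevel_injective`); `linError_eq`, `bilError_eq` identify the
  regrouped weights with `lemma55Term ψ 1 n q`, `lemma55Term ψ₁ ψ₂ n q`;
* `majorArc_remainder_bound` — summation over `q ≤ P`, interchange, LEMMA 5.5 (`lemma55`).
-/

noncomputable section

open MeasureTheory Set Finset Real Complex Classical
open scoped FourierTransform

namespace Literature.NumberTheory.Sieve.MontgomeryVaughan1975

/-! ### Cauchy–Schwarz for the arc integrals -/

/-- A continuous function is bounded on `[a, b]`; its norm is in every `L^p` of `(a, b]`. [folklore] -/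
theorem memLp_norm_restrict_Ioc {f : ℝ → ℂ} (hf : Continuous f) (a b : ℝ) (p : ENNReal) :
    MemLp (fun η => ‖f η‖) p (volume.restrict (Set.Ioc a b)) := by
  haveI : Fact (volume (Set.Ioc a b) < ⊤) := ⟨measure_Ioc_lt_top⟩
  obtain ⟨C, hC⟩ := (isCompact_Icc (a := a) (b := b)).exists_bound_of_continuousOn hf.continuousOn
  refine memLp_of_bounded (a := 0) (b := C) ?_ hf.norm.aestronglyMeasurable p
  rw [ae_restrict_iff' measurableSet_Ioc]
  exact Filter.Eventually.of_forall fun η hη => ⟨norm_nonneg _, hC η (Set.Ioc_subset_Icc_self hη)⟩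

/-- **Cauchy–Schwarz** for `∫_a^b f g e(−nη) dη`:
`|∫ f g e(−n·)| ≤ (∫ |f|²)^{1/2} (∫ |g|²)^{1/2}` (Montgomery–Vaughan 1975, p. 362: "we use (6.5) and
Cauchy's inequality"). [cite: MontgomeryVaughanActa1975, §6 (6.6)] -/
theorem norm_integral_mul_mul_fourierChar_le {f g : ℝ → ℂ} (hf : Continuous f) (hg : Continuous g)
    (n : ℕ) {a b : ℝ} (hab : a ≤ b) :
    ‖∫ η in a..b, f η * g η * (𝐞 (-(n * η)) : ℂ)‖ ≤
      (∫ η in a..b, ‖f η‖ ^ 2) ^ (1 / 2 : ℝ) * (∫ η in a..b, ‖g η‖ ^ 2) ^ (1 / 2 : ℝ) := by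
  have h1 : ‖∫ η in a..b, f η * g η * (𝐞 (-(n * η)) : ℂ)‖ ≤ ∫ η in a..b, ‖f η‖ * ‖g η‖ := by
    refine (intervalIntegral.norm_integral_le_integral_norm hab).trans (le_of_eq ?_)
    refine intervalIntegral.integral_congr fun η _ => ?_
    simp only [norm_mul, Circle.norm_coe, mul_one]
  refine h1.trans ?_
  rw [intervalIntegral.integral_of_le hab, intervalIntegral.integral_of_le hab,
    intervalIntegral.integral_of_le hab]
  have h2 := integral_mul_le_Lp_mul_Lq_of_nonneg (μ := volume.restrict (Set.Ioc a b))
    Real.HolderConjugate.two_two (Filter.Eventually.of_forall fun η => norm_nonneg (f η))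
    (Filter.Eventually.of_forall fun η => norm_nonneg (g η))
    (memLp_norm_restrict_Ioc hf a b _) (memLp_norm_restrict_Ioc hg a b _)
  simpa using h2

/-! ### Parseval for trigonometric polynomials and (6.7) -/

/-- **Parseval**: `∫_c^{c+1} |∑_{k∈A} u_k e(kα)|² dα = ∑_{k∈A} |u_k|²`. [folklore] -/
theorem integral_norm_trigPoly_sq (A : Finset ℕ) (u : ℕ → ℂ) (c : ℝ) :
    ∫ α in c..c + 1, ‖∑ k ∈ A, u k * (𝐞 (k * α) : ℂ)‖ ^ 2 = ∑ k ∈ A, ‖u k‖ ^ 2 := by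
  have hexp : ∀ α : ℝ, ((‖∑ k ∈ A, u k * (𝐞 (k * α) : ℂ)‖ ^ 2 : ℝ) : ℂ) =
      ∑ k₁ ∈ A, ∑ k₂ ∈ A, u k₁ * (starRingEnd ℂ) (u k₂) * (𝐞 (((k₁ : ℝ) - k₂) * α) : ℂ) := by
    intro α
    rw [Complex.ofReal_pow, ← Complex.mul_conj', map_sum, Finset.sum_mul_sum]
    refine Finset.sum_congr rfl fun k₁ _ => Finset.sum_congr rfl fun k₂ _ => ?_
    rw [map_mul (starRingEnd ℂ), Circle.starRingEnd_addChar]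
    have : (𝐞 (((k₁ : ℝ) - k₂) * α) : ℂ) = (𝐞 (k₁ * α) : ℂ) * (𝐞 (-(k₂ * α)) : ℂ) := by
      rw [← Circle.coe_mul, ← AddChar.map_add_eq_mul]
      congr 2; ring
    rw [this]; ring
  have hint : ∀ k₁ k₂ : ℕ, ∫ α in c..c + 1, u k₁ * (starRingEnd ℂ) (u k₂) * (𝐞 (((k₁ : ℝ) - k₂) * α) : ℂ) =
      if k₁ = k₂ then u k₁ * (starRingEnd ℂ) (u k₂) else 0 := by
    intro k₁ k₂
    have hfun : (fun α : ℝ => u k₁ * (starRingEnd ℂ) (u k₂) * (𝐞 (((k₁ : ℝ) - k₂) * α) : ℂ)) =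
        fun α : ℝ => u k₁ * (starRingEnd ℂ) (u k₂) * (𝐞 (((k₁ - k₂ : ℤ) : ℝ) * α) : ℂ) := by
      funext α; push_cast; rfl
    rw [hfun, intervalIntegral.integral_const_mul, integral_fourierChar_intCast_unitInterval]
    by_cases h : k₁ = k₂
    · rw [if_pos (by omega), if_pos h, mul_one]
    · rw [if_neg (by omega), if_neg h, mul_zero]
  have hcont : ∀ k₁ k₂ : ℕ, Continuous fun α : ℝ =>
      u k₁ * (starRingEnd ℂ) (u k₂) * (𝐞 (((k₁ : ℝ) - k₂) * α) : ℂ) := fun k₁ k₂ => by fun_prop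
  have hsum : ∀ k₁ ∈ A, ∫ α in c..c + 1, ∑ k₂ ∈ A, u k₁ * (starRingEnd ℂ) (u k₂) *
      (𝐞 (((k₁ : ℝ) - k₂) * α) : ℂ) = ((‖u k₁‖ ^ 2 : ℝ) : ℂ) := by
    intro k₁ hk₁
    rw [intervalIntegral.integral_finsetSum fun k₂ _ => (hcont k₁ k₂).intervalIntegrable _ _]
    simp_rw [hint]
    rw [Finset.sum_ite_eq, if_pos hk₁, Complex.mul_conj']
    norm_cast
  apply Complex.ofReal_injective
  rw [← intervalIntegral.integral_ofReal]
  simp_rw [hexp]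
  rw [intervalIntegral.integral_finsetSum fun k₁ _ =>
    (continuous_finsetSum _ fun k₂ _ => hcont k₁ k₂).intervalIntegrable _ _,
    Finset.sum_congr rfl hsum]
  push_cast
  rfl

/-- **(6.7)** `∫_{−h}^{h} |T(η)|² dη ≤ ∫ over a unit interval = #{P < k ≤ X} ≤ X` for `0 ≤ h ≤ 1/2`.
[cite: MontgomeryVaughanActa1975, §6 (6.7)] -/
theorem integral_norm_linSum_sq_le {P X h : ℝ} (hh0 : 0 ≤ h) (hh : h ≤ 1 / 2) (hX : 0 ≤ X) :
    ∫ η in (-h)..h, ‖linSum P X η‖ ^ 2 ≤ X := by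
  have hpars : ∫ η in (-(1 / 2 : ℝ))..(-(1 / 2 : ℝ)) + 1, ‖linSum P X η‖ ^ 2 = (intWindow P X).card := by
    have h := integral_norm_trigPoly_sq (intWindow P X) (fun _ => (1 : ℂ)) (-(1 / 2 : ℝ))
    simp only [one_mul, norm_one, one_pow, Finset.sum_const, nsmul_eq_mul, mul_one] at h
    rw [← h]
    rfl
  have hcont : Continuous fun η : ℝ => ‖linSum P X η‖ ^ 2 := by unfold linSum; fun_prop
  calc ∫ η in (-h)..h, ‖linSum P X η‖ ^ 2
      ≤ ∫ η in (-(1 / 2 : ℝ))..(-(1 / 2 : ℝ)) + 1, ‖linSum P X η‖ ^ 2 := by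
        apply intervalIntegral.integral_mono_interval (by linarith) (by linarith) (by linarith)
          (Filter.Eventually.of_forall fun η => sq_nonneg _) (hcont.intervalIntegrable _ _)
    _ = (intWindow P X).card := hpars
    _ ≤ X := card_intWindow_le hX

/-! ### `W(χ, η)` and `W(χ*)` for arbitrary characters mod `q ≤ P` -/

/-- `W(χ, η) = S(χ, η) − 𝟙_{χ = χ₀} T(η)` for a character `χ` mod `q` (Montgomery–Vaughan 1975, p. 361);
for `q ≤ P` this is `W(χ*, η)` (`wFun_changeLevel`). [cite: MontgomeryVaughanActa1975, §6 (6.2)] -/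
def wFun (P X : ℝ) {q : ℕ} (χ : DirichletCharacter ℂ q) (η : ℝ) : ℂ :=
  charExpSum P X χ η - if χ = 1 then linSum P X η else 0

/-- `W(χ*) = (∫_{−1/(rQ)}^{1/(rQ)} |W(χ,η)|² dη)^{1/2}`, `r` the conductor of `χ` (Montgomery–Vaughan
1975, (6.5)). [cite: MontgomeryVaughanActa1975, §6 (6.5)] -/
def wNorm (P Q X : ℝ) {q : ℕ} (χ : DirichletCharacter ℂ q) : ℝ :=
  errNorm Q χ.conductor (wFun P X χ)

/-- `S(χ, η) = 𝟙_{χ=χ₀} T(η) + W(χ, η)`. [cite: MontgomeryVaughanActa1975, §6 (6.2)] -/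
theorem charExpSum_eq_ite_add_wFun (P X : ℝ) {q : ℕ} (χ : DirichletCharacter ℂ q) (η : ℝ) :
    charExpSum P X χ η = (if χ = 1 then linSum P X η else 0) + wFun P X χ η := by
  rw [wFun]; ring

/-- For `ψ` primitive mod `r ∣ q`, `q ≤ P`: `W(ψχ₀, ·) = W(ψ, ·)` as defined for primitive characters
(`errSum`). [cite: MontgomeryVaughanActa1975, §6 (6.2)] -/
theorem wFun_changeLevel {P X : ℝ} {r q : ℕ} [NeZero q] (h : r ∣ q) (hq : 1 ≤ q) (hqP : (q : ℝ) ≤ P)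
    {ψ : DirichletCharacter ℂ r} (hψ : ψ.IsPrimitive) :
    wFun P X (DirichletCharacter.changeLevel h ψ) = errSum P X ψ := by
  haveI : NeZero r := ⟨fun h0 => by subst h0; exact (NeZero.ne q) (Nat.eq_zero_of_zero_dvd h)⟩
  funext η
  rw [wFun, errSum, charExpSum_changeLevel h hq hqP, DirichletCharacter.changeLevel_eq_one_iff h]
  congr 1
  have : ψ = 1 ↔ r = 1 := by
    constructor
    · intro h1
      have := hψ
      rw [DirichletCharacter.isPrimitive_def, h1, DirichletCharacter.conductor_one] at this
      exact this.symm
    · intro hr; subst hr; exact Subsingleton.elim _ _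
  simp only [this]

/-- Continuity of `W(χ, ·)`. [folklore] -/
theorem continuous_wFun (P X : ℝ) {q : ℕ} (χ : DirichletCharacter ℂ q) : Continuous (wFun P X χ) := by
  unfold wFun charExpSum linSum
  split_ifs <;> fun_prop

/-- Auxiliary. [folklore] -/
theorem wNorm_nonneg (P Q X : ℝ) {q : ℕ} (χ : DirichletCharacter ℂ q) : 0 ≤ wNorm P Q X χ :=
  errNorm_nonneg _ _ _

/-- `∫_{−1/(qQ)}^{1/(qQ)} |W(χ,η)|² dη ≤ W(χ*)²` (the range `1/(qQ)` is contained in `1/(rQ)`, `r ∣ q`).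
[cite: MontgomeryVaughanActa1975, §6 (6.5)] -/
theorem integral_norm_wFun_sq_le {P Q X : ℝ} (hQ : 0 < Q) {q : ℕ} [NeZero q] (χ : DirichletCharacter ℂ q) :
    ∫ η in (-(1 / (q * Q)))..(1 / (q * Q)), ‖wFun P X χ η‖ ^ 2 ≤ wNorm P Q X χ ^ 2 := by
  have hr0 : 0 < χ.conductor := Nat.pos_of_ne_zero (DirichletCharacter.conductor_ne_zero χ)
  have hrq : (χ.conductor : ℝ) ≤ q := by
    exact_mod_cast Nat.le_of_dvd (NeZero.pos q) (DirichletCharacter.conductor_dvd_level χ)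
  have hr0' : (0 : ℝ) < χ.conductor := by exact_mod_cast hr0
  have hle : 1 / ((q : ℝ) * Q) ≤ 1 / (χ.conductor * Q) := by
    apply one_div_le_one_div_of_le (by positivity)
    exact mul_le_mul_of_nonneg_right hrq hQ.le
  have hpos : 0 < 1 / ((q : ℝ) * Q) := by
    have : (0 : ℝ) < q := by exact_mod_cast NeZero.pos q
    positivity
  have hcont : Continuous fun η : ℝ => ‖wFun P X χ η‖ ^ 2 := (continuous_wFun P X χ).norm.pow 2
  have hI0 : 0 ≤ ∫ η in (-(1 / (χ.conductor * Q)))..(1 / (χ.conductor * Q)), ‖wFun P X χ η‖ ^ 2 :=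
    intervalIntegral.integral_nonneg (by linarith) fun η _ => sq_nonneg _
  rw [wNorm, errNorm, ← Real.sqrt_eq_rpow, Real.sq_sqrt hI0]
  exact intervalIntegral.integral_mono_interval (by linarith) (by linarith) hle
    (Filter.Eventually.of_forall fun η => sq_nonneg _) (hcont.intervalIntegrable _ _)

/-! ### The arc integrals `∫ S(χ,η) S(χ',η) e(−nη)` split by `S = 𝟙T + W` -/

/-- Linearity: `∫ (δT + W)(δ'T + W') e = δδ' ∫TTe + δ ∫TW'e + δ' ∫WTe + ∫WW'e`. [folklore] -/
theorem integral_split_four {T W W' e : ℝ → ℂ} (hT : Continuous T) (hW : Continuous W)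
    (hW' : Continuous W') (he : Continuous e) (δ δ' : ℂ) (a b : ℝ) :
    ∫ η in a..b, (δ * T η + W η) * (δ' * T η + W' η) * e η =
      δ * δ' * (∫ η in a..b, T η * T η * e η) + δ * (∫ η in a..b, T η * W' η * e η) +
        δ' * (∫ η in a..b, W η * T η * e η) + ∫ η in a..b, W η * W' η * e η := by
  have h1 : ∀ η, (δ * T η + W η) * (δ' * T η + W' η) * e η =
      δ * δ' * (T η * T η * e η) + δ * (T η * W' η * e η) + δ' * (W η * T η * e η) + W η * W' η * e η := by
    intro η; ring
  simp_rw [h1]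
  have i1 : IntervalIntegrable (fun η => δ * δ' * (T η * T η * e η)) volume a b :=
    Continuous.intervalIntegrable (by fun_prop) _ _
  have i2 : IntervalIntegrable (fun η => δ * (T η * W' η * e η)) volume a b :=
    Continuous.intervalIntegrable (by fun_prop) _ _
  have i3 : IntervalIntegrable (fun η => δ' * (W η * T η * e η)) volume a b :=
    Continuous.intervalIntegrable (by fun_prop) _ _
  have i4 : IntervalIntegrable (fun η => W η * W' η * e η) volume a b :=
    Continuous.intervalIntegrable (by fun_prop) _ _
  rw [intervalIntegral.integral_add ((i1.add i2).add i3) i4,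
    intervalIntegral.integral_add (i1.add i2) i3, intervalIntegral.integral_add i1 i2,
    intervalIntegral.integral_const_mul, intervalIntegral.integral_const_mul,
    intervalIntegral.integral_const_mul]

/-- Sums against the indicator of the principal character pick out `χ = 1`. [folklore] -/
theorem sum_ite_one_mul {q : ℕ} (F : DirichletCharacter ℂ q → ℂ) :
    ∑ χ : DirichletCharacter ℂ q, (if χ = 1 then (1 : ℂ) else 0) * F χ = F 1 := by
  rw [Finset.sum_eq_single_of_mem 1 (Finset.mem_univ _) (fun χ _ hχ => by rw [if_neg hχ, zero_mul]),
    if_pos rfl, one_mul]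

/-- `(∫ |f|²)^{1/2}` bounds: `(∫_{−h}^{h}|T|²)^{1/2} ≤ X^{1/2}` and `(∫_{−h}^{h}|W(χ,·)|²)^{1/2} ≤ W(χ*)`
for `h = 1/(qQ) ≤ 1/2`. [cite: MontgomeryVaughanActa1975, §6 (6.7)] -/
theorem rpow_integral_norm_linSum_sq_le {P X h : ℝ} (hh0 : 0 ≤ h) (hh : h ≤ 1 / 2) (hX : 0 ≤ X) :
    (∫ η in (-h)..h, ‖linSum P X η‖ ^ 2) ^ (1 / 2 : ℝ) ≤ X ^ (1 / 2 : ℝ) :=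
  Real.rpow_le_rpow (intervalIntegral.integral_nonneg (by linarith) fun η _ => sq_nonneg _)
    (integral_norm_linSum_sq_le hh0 hh hX) (by norm_num)

/-- Auxiliary. [folklore] -/
theorem rpow_integral_norm_wFun_sq_le {P Q X : ℝ} (hQ : 0 < Q) {q : ℕ} [NeZero q]
    (χ : DirichletCharacter ℂ q) :
    (∫ η in (-(1 / (q * Q)))..(1 / (q * Q)), ‖wFun P X χ η‖ ^ 2) ^ (1 / 2 : ℝ) ≤ wNorm P Q X χ := by
  have h0 : (0 : ℝ) ≤ 1 / (q * Q) := by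
    have : (0 : ℝ) < q := by exact_mod_cast NeZero.pos q
    positivity
  have hI0 : 0 ≤ ∫ η in (-(1 / (q * Q)))..(1 / (q * Q)), ‖wFun P X χ η‖ ^ 2 :=
    intervalIntegral.integral_nonneg (by linarith) fun η _ => sq_nonneg _
  calc (∫ η in (-(1 / (q * Q)))..(1 / (q * Q)), ‖wFun P X χ η‖ ^ 2) ^ (1 / 2 : ℝ)
      ≤ (wNorm P Q X χ ^ 2) ^ (1 / 2 : ℝ) :=
        Real.rpow_le_rpow hI0 (integral_norm_wFun_sq_le hQ χ) (by norm_num)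
    _ = wNorm P Q X χ := by
        rw [← Real.sqrt_eq_rpow, Real.sqrt_sq (wNorm_nonneg P Q X χ)]

/-- **The remainder of (6.4) at one modulus `q`, bounded as in (6.6)** (Montgomery–Vaughan 1975,
p. 362): with `h = 1/(qQ) ≤ 1/2`, `τ̄(χ) = τ(χ̄)`,
`|∑'_a ∫_{−h}^{h} S(a/q+η)² e(−n(a/q+η)) dη − φ(q)⁻² c_q(−n) τ̄(χ₀)² ∫_{−h}^{h} T² e(−nη)|`
` ≤ φ(q)⁻² (2 X^{1/2} |τ̄(χ₀)| ∑_χ |c_χ(−n)| |τ̄(χ)| W(χ*) + ∑_{χ,χ'} |c_{χχ'}(−n)| |τ̄(χ)| |τ̄(χ')| W(χ*) W(χ'*))`.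
[cite: MontgomeryVaughanActa1975, §6 (6.6)] -/
theorem norm_arcSum_sub_main_le {P Q X : ℝ} (hX : 0 ≤ X) (hQ : 0 < Q) {q : ℕ} [NeZero q] (hq : 1 ≤ q)
    (hqP : (q : ℝ) ≤ P) (hqQ : 2 ≤ (q : ℝ) * Q) (n : ℕ) :
    ‖(∑ a ∈ (Finset.Icc 1 q).filter (fun a : ℕ => a.Coprime q),
        ∫ η in (-(1 / (q * Q)))..(1 / (q * Q)),
          expSum P X ((a : ℝ) / q + η) ^ 2 * (𝐞 (-(n * ((a : ℝ) / q + η))) : ℂ)) -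
      ((q.totient : ℂ)⁻¹) ^ 2 * (charGauss (1 : DirichletCharacter ℂ q) ((-(n : ℤ) : ℤ) : ZMod q) *
        (gaussSum (1 : DirichletCharacter ℂ q)⁻¹ ZMod.stdAddChar) ^ 2 *
        ∫ η in (-(1 / (q * Q)))..(1 / (q * Q)), linSum P X η * linSum P X η * (𝐞 (-(n * η)) : ℂ))‖ ≤
      ((q.totient : ℝ)⁻¹) ^ 2 *
        (2 * X ^ (1 / 2 : ℝ) * ‖gaussSum (1 : DirichletCharacter ℂ q)⁻¹ ZMod.stdAddChar‖ *
          ∑ χ : DirichletCharacter ℂ q, ‖charGauss χ ((-(n : ℤ) : ℤ) : ZMod q)‖ *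
            ‖gaussSum χ⁻¹ ZMod.stdAddChar‖ * wNorm P Q X χ +
        ∑ χ : DirichletCharacter ℂ q, ∑ χ' : DirichletCharacter ℂ q,
          ‖charGauss (χ * χ') ((-(n : ℤ) : ℤ) : ZMod q)‖ * ‖gaussSum χ⁻¹ ZMod.stdAddChar‖ *
            ‖gaussSum χ'⁻¹ ZMod.stdAddChar‖ * wNorm P Q X χ * wNorm P Q X χ') := by
  -- notation
  set h : ℝ := 1 / (q * Q) with hh
  have hq0 : (0 : ℝ) < q := by exact_mod_cast hq
  have hh0 : 0 < h := by rw [hh]; positivity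
  have hh2 : h ≤ 1 / 2 := by rw [hh]; exact one_div_le_one_div_of_le (by norm_num) hqQ
  set τ' : DirichletCharacter ℂ q → ℂ := fun χ => gaussSum χ⁻¹ ZMod.stdAddChar with hτ'
  set cG : DirichletCharacter ℂ q → ℂ := fun χ => charGauss χ ((-(n : ℤ) : ℤ) : ZMod q) with hcG
  set T : ℝ → ℂ := linSum P X with hT
  set Wf : DirichletCharacter ℂ q → ℝ → ℂ := fun χ => wFun P X χ with hWf
  set e : ℝ → ℂ := fun η => (𝐞 (-(n * η)) : ℂ) with he
  set δ : DirichletCharacter ℂ q → ℂ := fun χ => if χ = 1 then 1 else 0 with hδ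
  set J₀ : ℂ := ∫ η in (-h)..h, T η * T η * e η with hJ₀
  set J₁ : DirichletCharacter ℂ q → ℂ := fun χ' => ∫ η in (-h)..h, T η * Wf χ' η * e η with hJ₁
  set J₂ : DirichletCharacter ℂ q → ℂ := fun χ => ∫ η in (-h)..h, Wf χ η * T η * e η with hJ₂
  set J₃ : DirichletCharacter ℂ q → DirichletCharacter ℂ q → ℂ :=
    fun χ χ' => ∫ η in (-h)..h, Wf χ η * Wf χ' η * e η with hJ₃
  set w : DirichletCharacter ℂ q → ℝ := fun χ => wNorm P Q X χ with hw
  have hTc : Continuous T := by rw [hT]; unfold linSum; fun_prop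
  have hWc : ∀ χ, Continuous (Wf χ) := fun χ => continuous_wFun P X χ
  have hec : Continuous e := by rw [he]; fun_prop
  -- Step 1: (6.4) general form and the split of each `∫ S S' e`
  have hA := sum_coprime_integral_expSum_sq_eq (P := P) (X := X) hq hqP n h
  have hS : ∀ χ : DirichletCharacter ℂ q, ∀ η : ℝ, charExpSum P X χ η = δ χ * T η + Wf χ η := by
    intro χ η
    rw [charExpSum_eq_ite_add_wFun]
    simp only [hδ, hT, hWf]
    split_ifs <;> simp
  have hI : ∀ χ χ' : DirichletCharacter ℂ q,
      ∫ η in (-h)..h, charExpSum P X χ η * charExpSum P X χ' η * (𝐞 (-(n * η)) : ℂ) =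
        δ χ * δ χ' * J₀ + δ χ * J₁ χ' + δ χ' * J₂ χ + J₃ χ χ' := by
    intro χ χ'
    have := integral_split_four hTc (hWc χ) (hWc χ') hec (δ χ) (δ χ') (-h) h
    simp only [hJ₀, hJ₁, hJ₂, hJ₃]
    rw [← this]
    refine intervalIntegral.integral_congr fun η _ => ?_
    simp only [hS]
    rfl
  -- Step 2: the algebra of the `δ`'s: `A = φ⁻² (cG 1 τ'1² J₀ + E₁ + E₂ + E₃)`
  set E₁ : ℂ := ∑ χ' : DirichletCharacter ℂ q, cG χ' * (τ' 1 * τ' χ') * J₁ χ' with hE₁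
  set E₂ : ℂ := ∑ χ : DirichletCharacter ℂ q, cG χ * (τ' χ * τ' 1) * J₂ χ with hE₂
  set E₃ : ℂ := ∑ χ : DirichletCharacter ℂ q, ∑ χ' : DirichletCharacter ℂ q,
    cG (χ * χ') * (τ' χ * τ' χ') * J₃ χ χ' with hE₃
  have hsum : ∑ χ : DirichletCharacter ℂ q, ∑ χ' : DirichletCharacter ℂ q,
      cG (χ * χ') * (τ' χ * τ' χ' * (δ χ * δ χ' * J₀ + δ χ * J₁ χ' + δ χ' * J₂ χ + J₃ χ χ')) =
      cG 1 * (τ' 1) ^ 2 * J₀ + E₁ + E₂ + E₃ := by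
    have hsplit : ∀ χ χ' : DirichletCharacter ℂ q,
        cG (χ * χ') * (τ' χ * τ' χ' * (δ χ * δ χ' * J₀ + δ χ * J₁ χ' + δ χ' * J₂ χ + J₃ χ χ')) =
        δ χ * (δ χ' * (cG (χ * χ') * (τ' χ * τ' χ') * J₀)) + δ χ * (cG (χ * χ') * (τ' χ * τ' χ') * J₁ χ') +
          δ χ' * (cG (χ * χ') * (τ' χ * τ' χ') * J₂ χ) + cG (χ * χ') * (τ' χ * τ' χ') * J₃ χ χ' := by
      intro χ χ'; ring
    simp_rw [hsplit, Finset.sum_add_distrib]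
    have hδsum : ∀ F : DirichletCharacter ℂ q → ℂ, ∑ χ : DirichletCharacter ℂ q, δ χ * F χ = F 1 :=
      fun F => by
        simp only [hδ]
        rw [Finset.sum_eq_single_of_mem 1 (Finset.mem_univ _)
          (fun χ _ hχ => by rw [if_neg hχ, zero_mul]), if_pos rfl, one_mul]
    have e1 : ∑ χ : DirichletCharacter ℂ q, ∑ χ' : DirichletCharacter ℂ q,
        δ χ * (δ χ' * (cG (χ * χ') * (τ' χ * τ' χ') * J₀)) = cG 1 * (τ' 1) ^ 2 * J₀ := by
      simp_rw [← Finset.mul_sum]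
      rw [hδsum (fun χ => ∑ i : DirichletCharacter ℂ q, δ i * (cG (χ * i) * (τ' χ * τ' i) * J₀)),
        hδsum (fun i => cG (1 * i) * (τ' 1 * τ' i) * J₀), mul_one, sq]
    have e2 : ∑ χ : DirichletCharacter ℂ q, ∑ χ' : DirichletCharacter ℂ q,
        δ χ * (cG (χ * χ') * (τ' χ * τ' χ') * J₁ χ') = E₁ := by
      simp_rw [← Finset.mul_sum]
      rw [hδsum (fun χ => ∑ i : DirichletCharacter ℂ q, cG (χ * i) * (τ' χ * τ' i) * J₁ i)]
      simp only [one_mul, hE₁]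
    have e3 : ∑ χ : DirichletCharacter ℂ q, ∑ χ' : DirichletCharacter ℂ q,
        δ χ' * (cG (χ * χ') * (τ' χ * τ' χ') * J₂ χ) = E₂ := by
      rw [hE₂]
      refine Finset.sum_congr rfl fun χ _ => ?_
      rw [hδsum fun χ' => cG (χ * χ') * (τ' χ * τ' χ') * J₂ χ, mul_one]
    rw [e1, e2, e3]
  have hArepr : (∑ a ∈ (Finset.Icc 1 q).filter (fun a : ℕ => a.Coprime q),
        ∫ η in (-h)..h, expSum P X ((a : ℝ) / q + η) ^ 2 * (𝐞 (-(n * ((a : ℝ) / q + η))) : ℂ)) -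
      ((q.totient : ℂ)⁻¹) ^ 2 * (cG 1 * (τ' 1) ^ 2 * J₀) =
      ((q.totient : ℂ)⁻¹) ^ 2 * (E₁ + E₂ + E₃) := by
    rw [hA]
    simp_rw [hI]
    rw [hsum]; ring
  -- Step 3: Cauchy–Schwarz bounds for `J₁, J₂, J₃`
  have hX2 : 0 ≤ X ^ (1 / 2 : ℝ) := Real.rpow_nonneg hX _
  have hTn : (∫ η in (-h)..h, ‖T η‖ ^ 2) ^ (1 / 2 : ℝ) ≤ X ^ (1 / 2 : ℝ) :=
    rpow_integral_norm_linSum_sq_le hh0.le hh2 hX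
  have hWn : ∀ χ, (∫ η in (-h)..h, ‖Wf χ η‖ ^ 2) ^ (1 / 2 : ℝ) ≤ w χ := fun χ =>
    rpow_integral_norm_wFun_sq_le hQ χ
  have hw0 : ∀ χ, 0 ≤ w χ := fun χ => wNorm_nonneg P Q X χ
  have hI0 : ∀ f : ℝ → ℂ, 0 ≤ (∫ η in (-h)..h, ‖f η‖ ^ 2) ^ (1 / 2 : ℝ) := fun f =>
    Real.rpow_nonneg (intervalIntegral.integral_nonneg (by linarith) fun η _ => sq_nonneg _) _
  have hJ₁b : ∀ χ', ‖J₁ χ'‖ ≤ X ^ (1 / 2 : ℝ) * w χ' := fun χ' =>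
    (norm_integral_mul_mul_fourierChar_le hTc (hWc χ') n (by linarith)).trans
      (mul_le_mul hTn (hWn χ') (hI0 _) hX2)
  have hJ₂b : ∀ χ, ‖J₂ χ‖ ≤ w χ * X ^ (1 / 2 : ℝ) := fun χ =>
    (norm_integral_mul_mul_fourierChar_le (hWc χ) hTc n (by linarith)).trans
      (mul_le_mul (hWn χ) hTn (hI0 _) (hw0 χ))
  have hJ₃b : ∀ χ χ', ‖J₃ χ χ'‖ ≤ w χ * w χ' := fun χ χ' =>
    (norm_integral_mul_mul_fourierChar_le (hWc χ) (hWc χ') n (by linarith)).trans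
      (mul_le_mul (hWn χ) (hWn χ') (hI0 _) (hw0 χ))
  -- Step 4: assemble
  have hE₁b : ‖E₁‖ ≤ X ^ (1 / 2 : ℝ) * ‖τ' 1‖ * ∑ χ : DirichletCharacter ℂ q, ‖cG χ‖ * ‖τ' χ‖ * w χ := by
    rw [hE₁, Finset.mul_sum]
    refine (norm_sum_le _ _).trans (Finset.sum_le_sum fun χ' _ => ?_)
    rw [norm_mul, norm_mul, norm_mul]
    calc ‖cG χ'‖ * (‖τ' 1‖ * ‖τ' χ'‖) * ‖J₁ χ'‖ ≤ ‖cG χ'‖ * (‖τ' 1‖ * ‖τ' χ'‖) * (X ^ (1 / 2 : ℝ) * w χ') :=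
          mul_le_mul_of_nonneg_left (hJ₁b χ') (by positivity)
      _ = X ^ (1 / 2 : ℝ) * ‖τ' 1‖ * (‖cG χ'‖ * ‖τ' χ'‖ * w χ') := by ring
  have hE₂b : ‖E₂‖ ≤ X ^ (1 / 2 : ℝ) * ‖τ' 1‖ * ∑ χ : DirichletCharacter ℂ q, ‖cG χ‖ * ‖τ' χ‖ * w χ := by
    rw [hE₂, Finset.mul_sum]
    refine (norm_sum_le _ _).trans (Finset.sum_le_sum fun χ _ => ?_)
    rw [norm_mul, norm_mul, norm_mul]
    calc ‖cG χ‖ * (‖τ' χ‖ * ‖τ' 1‖) * ‖J₂ χ‖ ≤ ‖cG χ‖ * (‖τ' χ‖ * ‖τ' 1‖) * (w χ * X ^ (1 / 2 : ℝ)) :=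
          mul_le_mul_of_nonneg_left (hJ₂b χ) (by positivity)
      _ = X ^ (1 / 2 : ℝ) * ‖τ' 1‖ * (‖cG χ‖ * ‖τ' χ‖ * w χ) := by ring
  have hE₃b : ‖E₃‖ ≤ ∑ χ : DirichletCharacter ℂ q, ∑ χ' : DirichletCharacter ℂ q,
      ‖cG (χ * χ')‖ * ‖τ' χ‖ * ‖τ' χ'‖ * w χ * w χ' := by
    rw [hE₃]
    refine (norm_sum_le _ _).trans (Finset.sum_le_sum fun χ _ => ?_)
    refine (norm_sum_le _ _).trans (Finset.sum_le_sum fun χ' _ => ?_)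
    rw [norm_mul, norm_mul, norm_mul]
    calc ‖cG (χ * χ')‖ * (‖τ' χ‖ * ‖τ' χ'‖) * ‖J₃ χ χ'‖
        ≤ ‖cG (χ * χ')‖ * (‖τ' χ‖ * ‖τ' χ'‖) * (w χ * w χ') :=
          mul_le_mul_of_nonneg_left (hJ₃b χ χ') (by positivity)
      _ = _ := by ring
  have hφ : ‖((q.totient : ℂ)⁻¹) ^ 2‖ = ((q.totient : ℝ)⁻¹) ^ 2 := by
    rw [norm_pow, norm_inv, Complex.norm_natCast]
  -- the main-term expression in the statement is `φ⁻² (cG 1 τ'1² J₀)`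
  have hmain : ((q.totient : ℂ)⁻¹) ^ 2 * (charGauss (1 : DirichletCharacter ℂ q) ((-(n : ℤ) : ℤ) : ZMod q) *
        (gaussSum (1 : DirichletCharacter ℂ q)⁻¹ ZMod.stdAddChar) ^ 2 *
        ∫ η in (-(1 / (q * Q)))..(1 / (q * Q)), linSum P X η * linSum P X η * (𝐞 (-(n * η)) : ℂ)) =
      ((q.totient : ℂ)⁻¹) ^ 2 * (cG 1 * (τ' 1) ^ 2 * J₀) := by
    simp only [hcG, hτ', hJ₀, hT, he, hh]
  rw [hmain, hArepr, norm_mul, hφ]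
  apply mul_le_mul_of_nonneg_left _ (by positivity)
  calc ‖E₁ + E₂ + E₃‖ ≤ ‖E₁‖ + ‖E₂‖ + ‖E₃‖ := norm_add₃_le
    _ ≤ _ := by
        have := add_le_add (add_le_add hE₁b hE₂b) hE₃b
        refine this.trans (le_of_eq ?_)
        simp only [hcG, hτ', hw]
        ring

/-! ### Regrouping `∑_{χ mod q}` by primitive characters `ψ` mod `r ∣ q` -/

/-- The character mod `q` induced by `ψ` mod `r` when `r ∣ q` (and `1` otherwise): a total version
of `changeLevel`. [folklore] -/
def liftChar (r q : ℕ) (ψ : DirichletCharacter ℂ r) : DirichletCharacter ℂ q :=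
  if h : r ∣ q then DirichletCharacter.changeLevel h ψ else 1

/-- Auxiliary. [folklore] -/
theorem liftChar_of_dvd {r q : ℕ} (h : r ∣ q) (ψ : DirichletCharacter ℂ r) :
    liftChar r q ψ = DirichletCharacter.changeLevel h ψ := by
  rw [liftChar, dif_pos h]

/-- If `ψ` is primitive mod `r ∣ q` and `ψχ₀ = χ` then `r` is the conductor of `χ`. [folklore] -/
theorem eq_conductor_of_changeLevel_eq {r q : ℕ} [NeZero q] (h : r ∣ q) {ψ : DirichletCharacter ℂ r}
    (hψ : ψ.IsPrimitive) {χ : DirichletCharacter ℂ q} (he : DirichletCharacter.changeLevel h ψ = χ) :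
    r = χ.conductor := by
  rw [← he, ψ.conductor_changeLevel h]
  exact hψ.symm

/-- Each `χ` mod `q` has exactly one representation `χ = ψχ₀` with `ψ` primitive mod `r ∣ q`:
`∑_{r ∣ q} ∑*_{ψ mod r} [ψχ₀ = χ] F = F`. [folklore] -/
theorem sum_divisors_sum_primitive_ite_eq {q : ℕ} [NeZero q] (χ : DirichletCharacter ℂ q) (F : ℝ) :
    ∑ r ∈ q.divisors, ∑ ψ : DirichletCharacter ℂ r with ψ.IsPrimitive,
      (if liftChar r q ψ = χ then F else 0) = F := by
  rw [Finset.sum_eq_single_of_mem χ.conductor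
    (Nat.mem_divisors.mpr ⟨χ.conductor_dvd_level, NeZero.ne q⟩)]
  · -- the conductor: only `ψ = χ.primitiveCharacter` contributes
    rw [Finset.sum_eq_single_of_mem χ.primitiveCharacter
      (Finset.mem_filter.mpr ⟨Finset.mem_univ _, χ.primitiveCharacter_isPrimitive⟩)]
    · rw [liftChar_of_dvd χ.conductor_dvd_level, if_pos χ.changeLevel_primitiveCharacter]
    · intro ψ hψ hne
      rw [Finset.mem_filter] at hψ
      rw [if_neg]
      intro he
      rw [liftChar_of_dvd χ.conductor_dvd_level] at he
      apply hne
      apply DirichletCharacter.changeLevel_injective χ.conductor_dvd_level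
      rw [he, χ.changeLevel_primitiveCharacter]
  · -- other divisors contribute nothing
    intro r hr hne
    refine Finset.sum_eq_zero fun ψ hψ => ?_
    rw [Finset.mem_filter] at hψ
    rw [if_neg]
    intro he
    rw [liftChar_of_dvd (Nat.dvd_of_mem_divisors hr)] at he
    exact hne (eq_conductor_of_changeLevel_eq _ hψ.2 he)

/-- **Regrouping**: `∑_{χ mod q} G(χ) = ∑_{r ∣ q} ∑*_{ψ mod r} G(ψχ₀)` — every character mod `q` is
induced by a unique primitive character. [folklore] -/
theorem sum_char_eq_sum_divisors_primitive {q : ℕ} [NeZero q] (G : DirichletCharacter ℂ q → ℝ) :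
    ∑ χ : DirichletCharacter ℂ q, G χ =
      ∑ r ∈ q.divisors, ∑ ψ : DirichletCharacter ℂ r with ψ.IsPrimitive, G (liftChar r q ψ) := by
  have hrepr : ∀ (r : ℕ) (ψ : DirichletCharacter ℂ r), G (liftChar r q ψ) =
      ∑ χ : DirichletCharacter ℂ q, if liftChar r q ψ = χ then G χ else 0 := by
    intro r ψ
    rw [Finset.sum_ite_eq, if_pos (Finset.mem_univ _)]
  simp_rw [hrepr]
  have hswap : ∀ r : ℕ, ∑ ψ : DirichletCharacter ℂ r with ψ.IsPrimitive,
      ∑ χ : DirichletCharacter ℂ q, (if liftChar r q ψ = χ then G χ else 0) =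
      ∑ χ : DirichletCharacter ℂ q, ∑ ψ : DirichletCharacter ℂ r with ψ.IsPrimitive,
        (if liftChar r q ψ = χ then G χ else 0) := fun r => Finset.sum_comm
  simp_rw [hswap]
  rw [Finset.sum_comm]
  exact Finset.sum_congr rfl fun χ _ => (sum_divisors_sum_primitive_ite_eq χ (G χ)).symm

/-! ### Identification of the regrouped terms with LEMMA 5.5 -/

/-- `W((ψχ₀)*) = W(ψ)` for `ψ` primitive mod `r ∣ q`, `q ≤ P`. [cite: MontgomeryVaughanActa1975, §6 (6.5)] -/
theorem wNorm_changeLevel {P Q X : ℝ} {r q : ℕ} [NeZero q] (h : r ∣ q) (hq : 1 ≤ q) (hqP : (q : ℝ) ≤ P)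
    {ψ : DirichletCharacter ℂ r} (hψ : ψ.IsPrimitive) :
    wNorm P Q X (DirichletCharacter.changeLevel h ψ) = errNorm Q r (errSum P X ψ) := by
  rw [wNorm, wFun_changeLevel h hq hqP hψ, ψ.conductor_changeLevel h, hψ]

/-- The linear-term weight is the summand of LEMMA 5.5 with `χ₂` trivial:
`φ(q)⁻² |τ(χ̄₀)| |c_{ψχ₀}(−n)| |τ((ψχ₀)⁻¹)| = lemma55Term ψ 1 n q`. [cite: MontgomeryVaughanActa1975, §5 Lemma 5.5 (5.4)] -/
theorem linWeight_eq_lemma55Term {r q : ℕ} [NeZero q] (h : r ∣ q) (ψ : DirichletCharacter ℂ r) (n : ℕ) :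
    ((q.totient : ℝ)⁻¹) ^ 2 * ‖gaussSum (1 : DirichletCharacter ℂ q)⁻¹ ZMod.stdAddChar‖ *
      (‖charGauss (DirichletCharacter.changeLevel h ψ) ((-(n : ℤ) : ℤ) : ZMod q)‖ *
        ‖gaussSum (DirichletCharacter.changeLevel h ψ)⁻¹ ZMod.stdAddChar‖) =
      lemma55Term ψ (1 : DirichletCharacter ℂ 1) n q := by
  rw [lemma55Term, dif_pos ⟨h, one_dvd q, NeZero.ne q⟩, DirichletCharacter.changeLevel_one, mul_one]
  have hneg : ((-(n : ℤ) : ℤ) : ZMod q) = -((n : ℕ) : ZMod q) := by push_cast; ring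
  rw [hneg, norm_charGauss_neg]
  field_simp

/-- The bilinear-term weight is the summand of LEMMA 5.5:
`φ(q)⁻² |c_{ψ₁χ₀ψ₂χ₀}(−n)| |τ((ψ₁χ₀)⁻¹)| |τ((ψ₂χ₀)⁻¹)| = lemma55Term ψ₁ ψ₂ n q`.
[cite: MontgomeryVaughanActa1975, §5 Lemma 5.5 (5.4)] -/
theorem bilWeight_eq_lemma55Term {r₁ r₂ q : ℕ} [NeZero q] (h₁ : r₁ ∣ q) (h₂ : r₂ ∣ q)
    (ψ₁ : DirichletCharacter ℂ r₁) (ψ₂ : DirichletCharacter ℂ r₂) (n : ℕ) :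
    ((q.totient : ℝ)⁻¹) ^ 2 *
      (‖charGauss (DirichletCharacter.changeLevel h₁ ψ₁ * DirichletCharacter.changeLevel h₂ ψ₂)
          ((-(n : ℤ) : ℤ) : ZMod q)‖ *
        ‖gaussSum (DirichletCharacter.changeLevel h₁ ψ₁)⁻¹ ZMod.stdAddChar‖ *
        ‖gaussSum (DirichletCharacter.changeLevel h₂ ψ₂)⁻¹ ZMod.stdAddChar‖) =
      lemma55Term ψ₁ ψ₂ n q := by
  rw [lemma55Term, dif_pos ⟨h₁, h₂, NeZero.ne q⟩]
  have hneg : ((-(n : ℤ) : ℤ) : ZMod q) = -((n : ℕ) : ZMod q) := by push_cast; ring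
  rw [hneg, norm_charGauss_neg]
  field_simp

/-! ### The two error sums at a modulus `q` in LEMMA 5.5 form -/

/-- Auxiliary. [folklore] -/
theorem divisors_subset_Icc {q N : ℕ} (hq : q ≠ 0) (hqN : q ≤ N) : q.divisors ⊆ Finset.Icc 1 N := by
  intro r hr
  rw [Nat.mem_divisors] at hr
  rw [Finset.mem_Icc]
  exact ⟨Nat.pos_of_dvd_of_pos hr.1 (Nat.pos_of_ne_zero hq), (Nat.le_of_dvd (Nat.pos_of_ne_zero hq) hr.1).trans hqN⟩

/-- Auxiliary. [folklore] -/
theorem lemma55Term_eq_zero_left {r₁ r₂ : ℕ} (ψ₁ : DirichletCharacter ℂ r₁) (ψ₂ : DirichletCharacter ℂ r₂)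
    (m q : ℕ) (h : ¬ r₁ ∣ q) : lemma55Term ψ₁ ψ₂ m q = 0 := by
  rw [lemma55Term, dif_neg (fun h' => h h'.1)]

/-- Auxiliary. [folklore] -/
theorem lemma55Term_eq_zero_right {r₁ r₂ : ℕ} (ψ₁ : DirichletCharacter ℂ r₁) (ψ₂ : DirichletCharacter ℂ r₂)
    (m q : ℕ) (h : ¬ r₂ ∣ q) : lemma55Term ψ₁ ψ₂ m q = 0 := by
  rw [lemma55Term, dif_neg (fun h' => h h'.2.1)]

/-- Auxiliary. [folklore] -/
theorem not_dvd_of_mem_sdiff {q N r : ℕ} (hq : q ≠ 0) (hr : r ∈ Finset.Icc 1 N \ q.divisors) : ¬ r ∣ q := by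
  rw [Finset.mem_sdiff, Nat.mem_divisors] at hr
  exact fun h => hr.2 ⟨h, hq⟩

/-- **The linear error sum at `q`, regrouped**:
`φ(q)⁻² |τ(χ̄₀)| ∑_χ |c_χ(−n)| |τ(χ̄)| W(χ*) = ∑_{r≤P} ∑*_{ψ mod r} lemma55Term ψ 1 n q · W(ψ)`.
[cite: MontgomeryVaughanActa1975, §6 (6.8)] -/
theorem linError_eq {P Q X : ℝ} {q N : ℕ} [NeZero q] (hq : 1 ≤ q) (hqN : q ≤ N) (hqP : (q : ℝ) ≤ P) (n : ℕ) :
    ((q.totient : ℝ)⁻¹) ^ 2 * ‖gaussSum (1 : DirichletCharacter ℂ q)⁻¹ ZMod.stdAddChar‖ *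
        ∑ χ : DirichletCharacter ℂ q, ‖charGauss χ ((-(n : ℤ) : ℤ) : ZMod q)‖ *
          ‖gaussSum χ⁻¹ ZMod.stdAddChar‖ * wNorm P Q X χ =
      ∑ r ∈ Finset.Icc 1 N, ∑ ψ : DirichletCharacter ℂ r with ψ.IsPrimitive,
        lemma55Term ψ (1 : DirichletCharacter ℂ 1) n q * errNorm Q r (errSum P X ψ) := by
  rw [Finset.mul_sum, sum_char_eq_sum_divisors_primitive]
  rw [← Finset.sum_subset (divisors_subset_Icc (NeZero.ne q) hqN) (fun r hr hrn => by
    refine Finset.sum_eq_zero fun ψ _ => ?_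
    rw [lemma55Term_eq_zero_left _ _ _ _ (not_dvd_of_mem_sdiff (NeZero.ne q)
      (Finset.mem_sdiff.mpr ⟨hr, hrn⟩)), zero_mul])]
  refine Finset.sum_congr rfl fun r hr => Finset.sum_congr rfl fun ψ hψ => ?_
  have hd : r ∣ q := Nat.dvd_of_mem_divisors hr
  rw [Finset.mem_filter] at hψ
  rw [liftChar_of_dvd hd, wNorm_changeLevel hd hq hqP hψ.2, ← linWeight_eq_lemma55Term hd ψ n]
  ring

/-- **The bilinear error sum at `q`, regrouped**:
`φ(q)⁻² ∑_{χ,χ'} |c_{χχ'}(−n)| |τ(χ̄)| |τ(χ̄')| W(χ*) W(χ'*)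
 = ∑_{r₁,ψ₁} ∑_{r₂,ψ₂} lemma55Term ψ₁ ψ₂ n q · W(ψ₁) W(ψ₂)`. [cite: MontgomeryVaughanActa1975, §6 (6.8)] -/
theorem bilError_eq {P Q X : ℝ} {q N : ℕ} [NeZero q] (hq : 1 ≤ q) (hqN : q ≤ N) (hqP : (q : ℝ) ≤ P) (n : ℕ) :
    ((q.totient : ℝ)⁻¹) ^ 2 * ∑ χ : DirichletCharacter ℂ q, ∑ χ' : DirichletCharacter ℂ q,
        ‖charGauss (χ * χ') ((-(n : ℤ) : ℤ) : ZMod q)‖ * ‖gaussSum χ⁻¹ ZMod.stdAddChar‖ *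
          ‖gaussSum χ'⁻¹ ZMod.stdAddChar‖ * wNorm P Q X χ * wNorm P Q X χ' =
      ∑ r₁ ∈ Finset.Icc 1 N, ∑ ψ₁ : DirichletCharacter ℂ r₁ with ψ₁.IsPrimitive,
        ∑ r₂ ∈ Finset.Icc 1 N, ∑ ψ₂ : DirichletCharacter ℂ r₂ with ψ₂.IsPrimitive,
          lemma55Term ψ₁ ψ₂ n q * errNorm Q r₁ (errSum P X ψ₁) * errNorm Q r₂ (errSum P X ψ₂) := by
  have hsub := divisors_subset_Icc (NeZero.ne q) hqN
  -- regroup the inner sum, then the outer sum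
  rw [Finset.mul_sum]
  have hinner : ∀ χ : DirichletCharacter ℂ q,
      ((q.totient : ℝ)⁻¹) ^ 2 * ∑ χ' : DirichletCharacter ℂ q,
        ‖charGauss (χ * χ') ((-(n : ℤ) : ℤ) : ZMod q)‖ * ‖gaussSum χ⁻¹ ZMod.stdAddChar‖ *
          ‖gaussSum χ'⁻¹ ZMod.stdAddChar‖ * wNorm P Q X χ * wNorm P Q X χ' =
      ∑ r₂ ∈ q.divisors, ∑ ψ₂ : DirichletCharacter ℂ r₂ with ψ₂.IsPrimitive,
        ((q.totient : ℝ)⁻¹) ^ 2 *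
          (‖charGauss (χ * liftChar r₂ q ψ₂) ((-(n : ℤ) : ℤ) : ZMod q)‖ * ‖gaussSum χ⁻¹ ZMod.stdAddChar‖ *
            ‖gaussSum (liftChar r₂ q ψ₂)⁻¹ ZMod.stdAddChar‖ * wNorm P Q X χ * wNorm P Q X (liftChar r₂ q ψ₂)) := by
    intro χ
    rw [Finset.mul_sum, sum_char_eq_sum_divisors_primitive]
  simp_rw [hinner]
  rw [sum_char_eq_sum_divisors_primitive]
  -- extend both divisor sums to `Icc 1 N` and identify the summands
  rw [← Finset.sum_subset hsub (fun r₁ hr₁ hr₁n => by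
    refine Finset.sum_eq_zero fun ψ₁ _ => Finset.sum_eq_zero fun r₂ _ => Finset.sum_eq_zero fun ψ₂ _ => ?_
    rw [lemma55Term_eq_zero_left _ _ _ _ (not_dvd_of_mem_sdiff (NeZero.ne q)
      (Finset.mem_sdiff.mpr ⟨hr₁, hr₁n⟩)), zero_mul, zero_mul])]
  refine Finset.sum_congr rfl fun r₁ hr₁ => Finset.sum_congr rfl fun ψ₁ hψ₁ => ?_
  rw [← Finset.sum_subset hsub (fun r₂ hr₂ hr₂n => by
    refine Finset.sum_eq_zero fun ψ₂ _ => ?_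
    rw [lemma55Term_eq_zero_right _ _ _ _ (not_dvd_of_mem_sdiff (NeZero.ne q)
      (Finset.mem_sdiff.mpr ⟨hr₂, hr₂n⟩)), zero_mul, zero_mul])]
  refine Finset.sum_congr rfl fun r₂ hr₂ => Finset.sum_congr rfl fun ψ₂ hψ₂ => ?_
  have hd₁ : r₁ ∣ q := Nat.dvd_of_mem_divisors hr₁
  have hd₂ : r₂ ∣ q := Nat.dvd_of_mem_divisors hr₂
  rw [Finset.mem_filter] at hψ₁ hψ₂
  rw [liftChar_of_dvd hd₁, liftChar_of_dvd hd₂, wNorm_changeLevel hd₁ hq hqP hψ₁.2,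
    wNorm_changeLevel hd₂ hq hqP hψ₂.2, ← bilWeight_eq_lemma55Term hd₁ hd₂ ψ₁ ψ₂ n]
  ring

/-! ### (6.8): the major-arc remainder -/

/-- The main term at the modulus `q` (first term of (6.4)):
`φ(q)⁻² c_q(−n) τ(χ̄₀)² ∫_{−1/(qQ)}^{1/(qQ)} T(η)² e(−nη) dη` (`0` for `q = 0`).
[cite: MontgomeryVaughanActa1975, §6 (6.4)] -/
def majorArcMainTerm (P Q X : ℝ) (n q : ℕ) : ℂ :=
  if hq : q = 0 then 0 else
    haveI : NeZero q := ⟨hq⟩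
    ((q.totient : ℂ)⁻¹) ^ 2 * (charGauss (1 : DirichletCharacter ℂ q) ((-(n : ℤ) : ℤ) : ZMod q) *
      (gaussSum (1 : DirichletCharacter ℂ q)⁻¹ ZMod.stdAddChar) ^ 2 *
      ∫ η in (-(1 / (q * Q)))..(1 / (q * Q)), linSum P X η * linSum P X η * (𝐞 (-(n * η)) : ℂ))

/-- LEMMA 5.5 summed against nonnegative weights: `∑_{r,ψ} E(ψ) ∑_{q} lemma55Term ψ ψ₂ n q ≤ 4e² (n/φ(n)) ∑ E`.
[cite: MontgomeryVaughanActa1975, §5 Lemma 5.5 (5.4)] -/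
theorem sum_weight_mul_sum_lemma55Term_le {N : ℕ} {r₂ : ℕ} [NeZero r₂] {ψ₂ : DirichletCharacter ℂ r₂}
    (hψ₂ : ψ₂.IsPrimitive) {n : ℕ} (hn : n ≠ 0) (S : Finset ℕ) (E : (r : ℕ) → DirichletCharacter ℂ r → ℝ)
    (hE : ∀ r ψ, 0 ≤ E r ψ) :
    ∑ r ∈ Finset.Icc 1 N, ∑ ψ : DirichletCharacter ℂ r with ψ.IsPrimitive,
        E r ψ * ∑ q ∈ S, lemma55Term ψ ψ₂ n q ≤
      4 * Real.exp 2 * ((n : ℝ) / (Nat.totient n : ℝ)) *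
        ∑ r ∈ Finset.Icc 1 N, ∑ ψ : DirichletCharacter ℂ r with ψ.IsPrimitive, E r ψ := by
  rw [Finset.mul_sum]
  refine Finset.sum_le_sum fun r hr => ?_
  rw [Finset.mul_sum]
  refine Finset.sum_le_sum fun ψ hψ => ?_
  rw [Finset.mem_Icc] at hr
  rw [Finset.mem_filter] at hψ
  haveI : NeZero r := ⟨by omega⟩
  calc E r ψ * ∑ q ∈ S, lemma55Term ψ ψ₂ n q ≤ E r ψ * (4 * Real.exp 2 * ((n : ℝ) / (Nat.totient n : ℝ))) :=
        mul_le_mul_of_nonneg_left (lemma55 hψ.2 hψ₂ hn S) (hE r ψ)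
    _ = _ := by ring

/-- The same with the summed character in the second slot. [cite: MontgomeryVaughanActa1975, §5 Lemma 5.5 (5.4)] -/
theorem sum_weight_mul_sum_lemma55Term_le' {N : ℕ} {r₁ : ℕ} [NeZero r₁] {ψ₁ : DirichletCharacter ℂ r₁}
    (hψ₁ : ψ₁.IsPrimitive) {n : ℕ} (hn : n ≠ 0) (S : Finset ℕ) (E : (r : ℕ) → DirichletCharacter ℂ r → ℝ)
    (hE : ∀ r ψ, 0 ≤ E r ψ) :
    ∑ r ∈ Finset.Icc 1 N, ∑ ψ : DirichletCharacter ℂ r with ψ.IsPrimitive,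
        E r ψ * ∑ q ∈ S, lemma55Term ψ₁ ψ n q ≤
      4 * Real.exp 2 * ((n : ℝ) / (Nat.totient n : ℝ)) *
        ∑ r ∈ Finset.Icc 1 N, ∑ ψ : DirichletCharacter ℂ r with ψ.IsPrimitive, E r ψ := by
  rw [Finset.mul_sum]
  refine Finset.sum_le_sum fun r hr => ?_
  rw [Finset.mul_sum]
  refine Finset.sum_le_sum fun ψ hψ => ?_
  rw [Finset.mem_Icc] at hr
  rw [Finset.mem_filter] at hψ
  haveI : NeZero r := ⟨by omega⟩
  calc E r ψ * ∑ q ∈ S, lemma55Term ψ₁ ψ n q ≤ E r ψ * (4 * Real.exp 2 * ((n : ℝ) / (Nat.totient n : ℝ))) :=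
        mul_le_mul_of_nonneg_left (lemma55 hψ₁ hψ.2 hn S) (hE r ψ)
    _ = _ := by ring

/-- **(6.6)–(6.8) of Montgomery–Vaughan 1975** (p. 362–363: "Thus, by Lemma 5.5, the error terms in
(6.4) are (6.8) `≪ nφ(n)⁻¹ (W X^{1/2} + W²)`"): for `X ≥ 0`, `Q ≥ 2`, `2P < Q` and `n ≥ 1`,
`|R₁(n) − ∑_{q≤P} φ(q)⁻² c_q(−n) τ(χ̄₀)² ∫_{−1/qQ}^{1/qQ} T² e(−nη)| ≤ 4e² (n/φ(n)) (2 X^{1/2} W + W²)`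
with `W = errTotal P Q X` ((6.9), (6.5)). [cite: MontgomeryVaughanActa1975, §6 (6.8)] -/
theorem majorArc_remainder_bound {P Q X : ℝ} (hX : 0 ≤ X) (hP : 0 ≤ P) (hQ2 : 2 ≤ Q) (hPQ : 2 * P < Q)
    {n : ℕ} (hn : n ≠ 0) :
    ‖majorArcIntegral P Q X n - ∑ q ∈ Finset.Icc 1 ⌊P⌋₊, majorArcMainTerm P Q X n q‖ ≤
      4 * Real.exp 2 * ((n : ℝ) / (Nat.totient n : ℝ)) *
        (2 * X ^ (1 / 2 : ℝ) * errTotal P Q X + errTotal P Q X ^ 2) := by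
  have hQ : 0 < Q := by linarith
  set N := ⌊P⌋₊ with hN
  have hmem : ∀ q ∈ Finset.Icc 1 N, 1 ≤ q ∧ q ≤ N ∧ (q : ℝ) ≤ P ∧ 2 ≤ (q : ℝ) * Q := by
    intro q hq
    rw [Finset.mem_Icc] at hq
    have hq1 : (1 : ℝ) ≤ q := by exact_mod_cast hq.1
    refine ⟨hq.1, hq.2, (Nat.cast_le.mpr hq.2).trans (Nat.floor_le hP), ?_⟩
    nlinarith
  -- Step 1: `R₁ = ∑_q A_q`
  have h1 : majorArcIntegral P Q X n = ∑ q ∈ Finset.Icc 1 N,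
      ∑ a ∈ (Finset.Icc 1 q).filter (fun a : ℕ => a.Coprime q),
        ∫ η in (-(1 / (q * Q)))..(1 / (q * Q)),
          expSum P X ((a : ℝ) / q + η) ^ 2 * (𝐞 (-(n * ((a : ℝ) / q + η))) : ℂ) := by
    rw [majorArcIntegral_eq_sum hPQ hP X n]
    refine Finset.sum_congr rfl fun q hq => Finset.sum_congr rfl fun a _ => ?_
    have hqQ : 0 < (q : ℝ) * Q := by
      have := (hmem q hq).1
      have : (0 : ℝ) < q := by exact_mod_cast this
      positivity
    exact integral_majorArc_eq _ hqQ a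
  -- Step 2: per-modulus bound
  have h2 : ∀ q ∈ Finset.Icc 1 N,
      ‖(∑ a ∈ (Finset.Icc 1 q).filter (fun a : ℕ => a.Coprime q),
        ∫ η in (-(1 / (q * Q)))..(1 / (q * Q)),
          expSum P X ((a : ℝ) / q + η) ^ 2 * (𝐞 (-(n * ((a : ℝ) / q + η))) : ℂ)) -
        majorArcMainTerm P Q X n q‖ ≤
      2 * X ^ (1 / 2 : ℝ) * (∑ r ∈ Finset.Icc 1 N, ∑ ψ : DirichletCharacter ℂ r with ψ.IsPrimitive,
        lemma55Term ψ (1 : DirichletCharacter ℂ 1) n q * errNorm Q r (errSum P X ψ)) +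
      ∑ r₁ ∈ Finset.Icc 1 N, ∑ ψ₁ : DirichletCharacter ℂ r₁ with ψ₁.IsPrimitive,
        ∑ r₂ ∈ Finset.Icc 1 N, ∑ ψ₂ : DirichletCharacter ℂ r₂ with ψ₂.IsPrimitive,
          lemma55Term ψ₁ ψ₂ n q * errNorm Q r₁ (errSum P X ψ₁) * errNorm Q r₂ (errSum P X ψ₂) := by
    intro q hq
    obtain ⟨hq1, hqN, hqP, hqQ⟩ := hmem q hq
    haveI : NeZero q := ⟨by omega⟩
    rw [majorArcMainTerm, dif_neg (NeZero.ne q), ← linError_eq hq1 hqN hqP n, ← bilError_eq hq1 hqN hqP n]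
    refine (norm_arcSum_sub_main_le hX hQ hq1 hqP hqQ n).trans (le_of_eq ?_)
    ring
  -- Step 3: sum over `q` and swap the order of summation
  rw [h1, ← Finset.sum_sub_distrib]
  refine (norm_sum_le _ _).trans ((Finset.sum_le_sum h2).trans ?_)
  rw [Finset.sum_add_distrib, ← Finset.mul_sum]
  have hE0 : ∀ (r : ℕ) (ψ : DirichletCharacter ℂ r), 0 ≤ errNorm Q r (errSum P X ψ) :=
    fun r ψ => errNorm_nonneg _ _ _
  -- the linear sum
  have hlin : ∑ q ∈ Finset.Icc 1 N, ∑ r ∈ Finset.Icc 1 N, ∑ ψ : DirichletCharacter ℂ r with ψ.IsPrimitive,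
      lemma55Term ψ (1 : DirichletCharacter ℂ 1) n q * errNorm Q r (errSum P X ψ) ≤
      4 * Real.exp 2 * ((n : ℝ) / (Nat.totient n : ℝ)) * errTotal P Q X := by
    rw [Finset.sum_comm]
    have : ∀ r ∈ Finset.Icc 1 N, ∑ q ∈ Finset.Icc 1 N, ∑ ψ : DirichletCharacter ℂ r with ψ.IsPrimitive,
        lemma55Term ψ (1 : DirichletCharacter ℂ 1) n q * errNorm Q r (errSum P X ψ) =
        ∑ ψ : DirichletCharacter ℂ r with ψ.IsPrimitive,
          errNorm Q r (errSum P X ψ) * ∑ q ∈ Finset.Icc 1 N, lemma55Term ψ (1 : DirichletCharacter ℂ 1) n q := by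
      intro r _
      rw [Finset.sum_comm]
      refine Finset.sum_congr rfl fun ψ _ => ?_
      rw [Finset.mul_sum]
      exact Finset.sum_congr rfl fun q _ => mul_comm _ _
    rw [Finset.sum_congr rfl this, errTotal]
    exact sum_weight_mul_sum_lemma55Term_le DirichletCharacter.isPrimitive_one_level_one hn _ _ hE0
  -- the bilinear sum
  have hbil : ∑ q ∈ Finset.Icc 1 N, ∑ r₁ ∈ Finset.Icc 1 N, ∑ ψ₁ : DirichletCharacter ℂ r₁ with ψ₁.IsPrimitive,
      ∑ r₂ ∈ Finset.Icc 1 N, ∑ ψ₂ : DirichletCharacter ℂ r₂ with ψ₂.IsPrimitive,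
        lemma55Term ψ₁ ψ₂ n q * errNorm Q r₁ (errSum P X ψ₁) * errNorm Q r₂ (errSum P X ψ₂) ≤
      4 * Real.exp 2 * ((n : ℝ) / (Nat.totient n : ℝ)) * errTotal P Q X ^ 2 := by
    -- move `∑_q` innermost
    rw [Finset.sum_comm]
    have hswap : ∀ r₁ ∈ Finset.Icc 1 N, ∑ q ∈ Finset.Icc 1 N, ∑ ψ₁ : DirichletCharacter ℂ r₁ with ψ₁.IsPrimitive,
        ∑ r₂ ∈ Finset.Icc 1 N, ∑ ψ₂ : DirichletCharacter ℂ r₂ with ψ₂.IsPrimitive,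
          lemma55Term ψ₁ ψ₂ n q * errNorm Q r₁ (errSum P X ψ₁) * errNorm Q r₂ (errSum P X ψ₂) =
        ∑ ψ₁ : DirichletCharacter ℂ r₁ with ψ₁.IsPrimitive, errNorm Q r₁ (errSum P X ψ₁) *
          ∑ r₂ ∈ Finset.Icc 1 N, ∑ ψ₂ : DirichletCharacter ℂ r₂ with ψ₂.IsPrimitive,
            errNorm Q r₂ (errSum P X ψ₂) * ∑ q ∈ Finset.Icc 1 N, lemma55Term ψ₁ ψ₂ n q := by
      intro r₁ _
      rw [Finset.sum_comm]
      refine Finset.sum_congr rfl fun ψ₁ _ => ?_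
      rw [Finset.sum_comm, Finset.mul_sum]
      refine Finset.sum_congr rfl fun r₂ _ => ?_
      rw [Finset.sum_comm, Finset.mul_sum]
      refine Finset.sum_congr rfl fun ψ₂ _ => ?_
      rw [Finset.mul_sum, Finset.mul_sum]
      refine Finset.sum_congr rfl fun q _ => ?_
      ring
    rw [Finset.sum_congr rfl hswap]
    -- bound the inner `(r₂, ψ₂)` sums by Lemma 5.5, then the outer
    have hinner : ∀ r₁ ∈ Finset.Icc 1 N, ∀ ψ₁ ∈ (Finset.univ : Finset (DirichletCharacter ℂ r₁)).filter
        (fun ψ₁ => ψ₁.IsPrimitive),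
        ∑ r₂ ∈ Finset.Icc 1 N, ∑ ψ₂ : DirichletCharacter ℂ r₂ with ψ₂.IsPrimitive,
            errNorm Q r₂ (errSum P X ψ₂) * ∑ q ∈ Finset.Icc 1 N, lemma55Term ψ₁ ψ₂ n q ≤
          4 * Real.exp 2 * ((n : ℝ) / (Nat.totient n : ℝ)) * errTotal P Q X := by
      intro r₁ hr₁ ψ₁ hψ₁
      rw [Finset.mem_Icc] at hr₁
      rw [Finset.mem_filter] at hψ₁
      haveI : NeZero r₁ := ⟨by omega⟩
      rw [errTotal]
      exact sum_weight_mul_sum_lemma55Term_le' hψ₁.2 hn _ _ hE0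
    calc ∑ r₁ ∈ Finset.Icc 1 N, ∑ ψ₁ : DirichletCharacter ℂ r₁ with ψ₁.IsPrimitive,
          errNorm Q r₁ (errSum P X ψ₁) *
            ∑ r₂ ∈ Finset.Icc 1 N, ∑ ψ₂ : DirichletCharacter ℂ r₂ with ψ₂.IsPrimitive,
              errNorm Q r₂ (errSum P X ψ₂) * ∑ q ∈ Finset.Icc 1 N, lemma55Term ψ₁ ψ₂ n q
        ≤ ∑ r₁ ∈ Finset.Icc 1 N, ∑ ψ₁ : DirichletCharacter ℂ r₁ with ψ₁.IsPrimitive,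
            errNorm Q r₁ (errSum P X ψ₁) * (4 * Real.exp 2 * ((n : ℝ) / (Nat.totient n : ℝ)) * errTotal P Q X) := by
          refine Finset.sum_le_sum fun r₁ hr₁ => Finset.sum_le_sum fun ψ₁ hψ₁ => ?_
          exact mul_le_mul_of_nonneg_left (hinner r₁ hr₁ ψ₁ hψ₁) (hE0 r₁ ψ₁)
      _ = 4 * Real.exp 2 * ((n : ℝ) / (Nat.totient n : ℝ)) * errTotal P Q X ^ 2 := by
          simp_rw [← Finset.sum_mul]
          rw [errTotal]; ring
  -- combine
  have hX2 : 0 ≤ X ^ (1 / 2 : ℝ) := Real.rpow_nonneg hX _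
  calc 2 * X ^ (1 / 2 : ℝ) * (∑ q ∈ Finset.Icc 1 N, ∑ r ∈ Finset.Icc 1 N,
          ∑ ψ : DirichletCharacter ℂ r with ψ.IsPrimitive,
            lemma55Term ψ (1 : DirichletCharacter ℂ 1) n q * errNorm Q r (errSum P X ψ)) +
        ∑ q ∈ Finset.Icc 1 N, ∑ r₁ ∈ Finset.Icc 1 N, ∑ ψ₁ : DirichletCharacter ℂ r₁ with ψ₁.IsPrimitive,
          ∑ r₂ ∈ Finset.Icc 1 N, ∑ ψ₂ : DirichletCharacter ℂ r₂ with ψ₂.IsPrimitive,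
            lemma55Term ψ₁ ψ₂ n q * errNorm Q r₁ (errSum P X ψ₁) * errNorm Q r₂ (errSum P X ψ₂)
      ≤ 2 * X ^ (1 / 2 : ℝ) * (4 * Real.exp 2 * ((n : ℝ) / (Nat.totient n : ℝ)) * errTotal P Q X) +
          4 * Real.exp 2 * ((n : ℝ) / (Nat.totient n : ℝ)) * errTotal P Q X ^ 2 :=
        add_le_add (mul_le_mul_of_nonneg_left hlin (by positivity)) hbil
    _ = _ := by ring

end Literature.NumberTheory.Sieve.MontgomeryVaughan1975
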